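import Mathlib
import Summits.MatrixMultiplication.MatrixMultiplication.Theorems.GradedDesignFamily.Negative.FlatTraceRankFrame
import Summits.MatrixMultiplication.MatrixMultiplication.Theorems.GradedDesignFamily.Negative.FlatGramSumSq
import Summits.MatrixMultiplication.MatrixMultiplication.Theorems.GradedDesignFamily.Negative.FlatRestrict

/-!
# The flat-size lemma on `G = GL₂(K)` for the level-one test space
# (crux `LevelGradedCohnUmans.GradedDesignFamily`, stmt-MatrixMultiplication-7610; negative side,
# line `quadratic-extension-level-one-cell`, lead c8)

Let `K` be a finite field, `Q := |K|`, and let `F₁(ℝ) ≤ ℝ^{GL₂(K)}` be the real span of the level-one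
indicators `g ↦ [g·u = w]` (`u, w ∈ K²`).  For a finite set `Γ ⊆ GL₂(K)` and a real subspace
`W ≤ F₁(ℝ)` of test functions VANISHING on `Γ` (so that `Γ` has `F₁`-corank `≥ dim W`):

* `gl2Flat_card_le` —
  `|Γ| · (Q⁵ − ρ (Q² + Q − 1)) ≤ ρ · Q² (Q − 1)(2Q − 1)(Q + 1)`,  `ρ := Q³ + Q² − dim W`.

So a set of corank `≥ c·Q³` (`ρ ≤ (1−c)Q³ + Q²`) has at most `(2(1−c)/c + O(1/Q))·Q³` points: rank
deficiency in the `≈ Q³`-dimensional level-one space forces a set of size `O(Q³/c)` inside the group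
of order `≈ Q⁴`.  Under S3's clause the garbage `φ(SL₂ k)·(YY⁻¹∖1)·Z` has corank `≥ |φ(SL₂ k)|·|Z|`
(`gl2Flat_corank_of_separators`), which confines the whole design to `O(q³/c)` cosets of `SL₂(𝔽_q)`.

PROOF (all ingredients landed, this file is the arithmetic).  With `n := |Γ|`,
`n(x,y) := #{u ∈ K² : x·u = y·u}` and `ρ₀ := dim F₁(ℝ)|_Γ` (the rank of the Gram family
`c_{(u,w)} = ([x·u = w])_{x ∈ Γ}`):
(a) `Q⁴ n² ≤ ρ₀ · Σ_{x,y∈Γ} n(x,y)²` (`gl2Flat_trace_rank_frame`: Gram trace–rank inequality);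
(b) `Q · Σ_{x,y∈Γ} n(x,y)² ≤ n²(Q²+Q−1) + n·Q²(Q−1)(2Q−1)(Q+1)` (`gl2Flat_gram_sum_sq_le`: Bessel for
    the `Q+1` mutually orthogonal partitions `x ↦ x·u` of `M₂(K)`, plus `n(x,y) ∈ {1, Q}` off the
    diagonal);
(c) `ρ₀ + dim W ≤ Q³ + Q²` (`gl2Flat_restrict_finrank_le`: rank–nullity for restriction to `Γ`).
Then `Q⁵ n² ≤ ρ₀ (n² M + n N)` with `M := Q²+Q−1`, `N := Q²(Q−1)(2Q−1)(Q+1)`, i.e.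
`n (Q⁵ − ρ₀ M) ≤ ρ₀ N` for `n > 0`, and the claim follows by monotonicity in `ρ₀ ≤ ρ`.

Sorry-free; axioms `propext`, `Classical.choice`, `Quot.sound`.
-/

set_option linter.dupNamespace false

open scoped BigOperators

namespace Summit.MatrixMultiplication.MatrixMultiplication.Theorems.GradedDesignFamily.Negative

/-- The real arithmetic of the flat-size lemma: from `Q⁴ n² ≤ ρ₀ S`, `Q S ≤ n² M + n N`,
`ρ₀ ≤ ρ` and sign conditions, conclude `n (Q⁵ − ρ M) ≤ ρ N`. -/
theorem gl2Flat_card_le_arith {Q n ρ₀ ρ S M N : ℝ} (hQ : 0 ≤ Q) (hn : 0 ≤ n) (hρ₀ : 0 ≤ ρ₀)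
    (hρ : ρ₀ ≤ ρ) (hM : 0 ≤ M) (hN : 0 ≤ N)
    (ha : Q ^ 4 * n ^ 2 ≤ ρ₀ * S) (hb : Q * S ≤ n ^ 2 * M + n * N) :
    n * (Q ^ 5 - ρ * M) ≤ ρ * N := by
  -- `Q⁵ n² ≤ ρ₀ (n² M + n N)`
  have h1 : Q ^ 5 * n ^ 2 ≤ ρ₀ * (n ^ 2 * M + n * N) := by
    have := mul_le_mul_of_nonneg_left ha hQ
    have h' : Q * (ρ₀ * S) = ρ₀ * (Q * S) := by ring
    calc Q ^ 5 * n ^ 2 = Q * (Q ^ 4 * n ^ 2) := by ring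
      _ ≤ Q * (ρ₀ * S) := this
      _ = ρ₀ * (Q * S) := h'
      _ ≤ ρ₀ * (n ^ 2 * M + n * N) := mul_le_mul_of_nonneg_left hb hρ₀
  rcases hn.eq_or_lt with hn0 | hnpos
  · -- `n = 0`
    rw [← hn0, zero_mul]
    exact mul_nonneg (hρ₀.trans hρ) hN
  · -- `n > 0`: divide by `n`, then monotonicity in `ρ₀ ≤ ρ`
    have h2 : n * (Q ^ 5 - ρ₀ * M) ≤ ρ₀ * N := by
      have h3 : n * (n * (Q ^ 5 - ρ₀ * M)) ≤ n * (ρ₀ * N) := by nlinarith [h1]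
      exact le_of_mul_le_mul_left h3 hnpos
    have h4 : n * (Q ^ 5 - ρ * M) ≤ n * (Q ^ 5 - ρ₀ * M) := by
      apply mul_le_mul_of_nonneg_left _ hn
      nlinarith [mul_le_mul_of_nonneg_right hρ hM]
    calc n * (Q ^ 5 - ρ * M) ≤ n * (Q ^ 5 - ρ₀ * M) := h4
      _ ≤ ρ₀ * N := h2
      _ ≤ ρ * N := mul_le_mul_of_nonneg_right hρ hN

/-- **The flat-size lemma on `GL₂(K)` for the level-one test space.**  For a finite field `K`
(`Q = |K|`), a finite set `Γ ⊆ GL₂(K)` and a real subspace `W` of real level-one test functions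
(combinations of the indicators `g ↦ [g·u = w]`) all vanishing on `Γ`,
`|Γ|·(Q⁵ − ρ(Q²+Q−1)) ≤ ρ·Q²(Q−1)(2Q−1)(Q+1)` with `ρ := Q³ + Q² − dim W`; in particular corank
`≥ cQ³` forces `|Γ| ≤ (2(1−c)/c + O(1/Q))·Q³`.  (Gram trace–rank inequality + Bessel for the
`Q+1` orthogonal partitions `x ↦ x·u` of `M₂(K)`.) -/
theorem gl2Flat_card_le {K : Type} [Field K] [Fintype K] [DecidableEq K]
    (Γ : Finset (Matrix.GeneralLinearGroup (Fin 2) K))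
    (W : Submodule ℝ (Matrix.GeneralLinearGroup (Fin 2) K → ℝ))
    (hW : W ≤ Submodule.span ℝ (Set.range fun p : (Fin 2 → K) × (Fin 2 → K) =>
        fun g : Matrix.GeneralLinearGroup (Fin 2) K =>
          if (g : Matrix (Fin 2) (Fin 2) K).mulVec p.1 = p.2 then (1 : ℝ) else 0))
    (hvan : ∀ f ∈ W, ∀ x ∈ Γ, f x = 0) :
    (Γ.card : ℝ) * ((Fintype.card K : ℝ) ^ 5 -
        ((Fintype.card K : ℝ) ^ 3 + (Fintype.card K : ℝ) ^ 2 - Module.finrank ℝ W) *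
          ((Fintype.card K : ℝ) ^ 2 + Fintype.card K - 1)) ≤
      ((Fintype.card K : ℝ) ^ 3 + (Fintype.card K : ℝ) ^ 2 - Module.finrank ℝ W) *
        (Fintype.card K : ℝ) ^ 2 * ((Fintype.card K : ℝ) - 1) * (2 * (Fintype.card K : ℝ) - 1) *
          ((Fintype.card K : ℝ) + 1) := by
  have ha := gl2Flat_trace_rank_frame Γ
  have hb := gl2Flat_gram_sum_sq_le Γ
  have hc := gl2Flat_restrict_finrank_le Γ W hW hvan
  -- names
  set Q : ℝ := (Fintype.card K : ℝ) with hQdef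
  set n : ℝ := (Γ.card : ℝ) with hndef
  set ρ₀ : ℕ := Module.finrank ℝ (Submodule.span ℝ (Set.range fun p : (Fin 2 → K) × (Fin 2 → K) =>
      fun x : {x // x ∈ Γ} =>
        if ((x : Matrix.GeneralLinearGroup (Fin 2) K) : Matrix (Fin 2) (Fin 2) K).mulVec p.1 = p.2
        then (1 : ℝ) else 0)) with hρ₀def
  have hQ1 : (1 : ℝ) ≤ Q := by
    rw [hQdef]; exact_mod_cast Fintype.card_pos
  have hQ0 : (0 : ℝ) ≤ Q := zero_le_one.trans hQ1
  have hρ : (ρ₀ : ℝ) ≤ Q ^ 3 + Q ^ 2 - Module.finrank ℝ W := by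
    have : ((ρ₀ + Module.finrank ℝ W : ℕ) : ℝ) ≤ ((Fintype.card K ^ 3 + Fintype.card K ^ 2 : ℕ) : ℝ) := by
      exact_mod_cast hc
    push_cast at this
    rw [hQdef]; linarith
  have hM : (0 : ℝ) ≤ Q ^ 2 + Q - 1 := by nlinarith
  have hN : (0 : ℝ) ≤ Q ^ 2 * (Q - 1) * (2 * Q - 1) * (Q + 1) := by
    have h1 : (0 : ℝ) ≤ Q - 1 := by linarith
    have h2 : (0 : ℝ) ≤ 2 * Q - 1 := by linarith
    positivity
  have key := gl2Flat_card_le_arith (Q := Q) (n := n) (ρ₀ := (ρ₀ : ℝ))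
    (ρ := Q ^ 3 + Q ^ 2 - Module.finrank ℝ W)
    (S := ∑ x ∈ Γ, ∑ y ∈ Γ, ((Finset.univ.filter fun u : Fin 2 → K =>
      (x : Matrix (Fin 2) (Fin 2) K).mulVec u = (y : Matrix (Fin 2) (Fin 2) K).mulVec u).card : ℝ) ^ 2)
    (M := Q ^ 2 + Q - 1) (N := Q ^ 2 * (Q - 1) * (2 * Q - 1) * (Q + 1))
    hQ0 (by rw [hndef]; positivity) (by positivity) hρ hM hN ha (by rw [hQdef, hndef]; linarith [hb])
  -- reshape
  have e : (Q ^ 3 + Q ^ 2 - Module.finrank ℝ W) * (Q ^ 2 * (Q - 1) * (2 * Q - 1) * (Q + 1)) =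
      (Q ^ 3 + Q ^ 2 - Module.finrank ℝ W) * Q ^ 2 * (Q - 1) * (2 * Q - 1) * (Q + 1) := by ring
  rw [e] at key
  exact key

end Summit.MatrixMultiplication.MatrixMultiplication.Theorems.GradedDesignFamily.Negative
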